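import Mathlib
import HarnessLib
import Summits.Ventures.LatticeQCDFlow.Scoring.ChainTimeAverage
import Summits.Ventures.LatticeQCDFlow.Scoring.IndepMHKernelPositive

/-!
# The flow sampler's error bar has a certified FLOOR: the variance of every time average is at
# least its AR(1) value through the observable's own lag-one autocorrelation

HONEST FRAMING: exact (Metropolis-corrected) sampling algorithms for lattice gauge theory;
figures of merit are autocorrelation/cost numbers at stated couplings and volumes; no
continuum-physics claim.

Venture `LatticeQCDFlow` (cell pub-lqcd), topic `Scoring`; FANOUT row 8 (`s0-cpn-nemc`, GEN-12).
NEW WORK of the cell, not a published result; no definition is introduced.  Composition of the bridge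
`Scoring/ChainTimeAverage.lean` (`variance_timeAverage`: `Var[(1/N) Σ f(X_i)] = 2 τ_N(ρ_f) Var_π f / N`
for Mathlib's `Kernel.trajMeasure`), GEN-11's positivity of the flow-MCMC kernel
(`Scoring/IndepMHKernelPositive.lean`: `indepMH_acf_pow_le`, `ρ₁ᵗ ≤ ρ_t`) and row 11's closed
forms for the geometric autocorrelation (`Scoring/VarianceOfTheMean.lean`,
`tauInt_sub_tauIntN_geometric`; `Scoring/CalibrationTruths.lean`, `tauInt_geometric`).

## Content (`K = indepMH q w` with `w · q = π` a probability law — the exact flow sampler's kernel)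

* `tauIntN_mono` — `τ_N` is monotone in the autocorrelation sequence (Fejér weights `≥ 0`);
* **`indepMH_variance_timeAverage_ge`** — for every bounded measurable `f` and every `N ≥ 1`, along
  the chain started in `π`: `Var[(1/N) Σ_{i<N} f(X_i)] ≥ 2 τ_N(t ↦ ρ₁ᵗ) · Var_π f / N`, where
  `ρ₁ = ρ_f(1)` is the observable's own lag-one autocorrelation — the AR(1) chain through `ρ₁` is the
  BEST case (no hypothesis beyond boundedness; `Var_π f = 0` gives `0 ≤ Var`);
* **`indepMH_variance_timeAverage_ge_closed`** — the same in closed form for `0 ≤ ρ₁ < 1`: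
  `Var[(1/N) Σ_{i<N} f(X_i)] ≥ (Var_π f / N) · ((1 + ρ₁)/(1 − ρ₁) − 2ρ₁(1 − ρ₁^N)/(N(1 − ρ₁)²))`.

Reading (value-free, with `Scoring/SectorBottleneckFloor.lean`): for a sector indicator
`1 − ρ₁ = Φ/(a(1 − a)) ≤ q(Aᶜ)/(1 − π(A))`, so a flow that under-covers the other sectors forces not
only `τ_int` but the finite-`N` error bar of the sector frequency up, for every run length `N`, by a
certified amount.  NOT CLAIMED: any number of ours; non-positive kernels (HMC, heat bath: only the
Madras–Slade / odd-window statements hold there).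
-/

noncomputable section

namespace Summit.Ventures.LatticeQCDFlow.Scoring

open MeasureTheory ProbabilityTheory Filter Finset Preorder Summit.Ventures.LatticeQCDFlow.Exactness
open scoped ENNReal

variable {Ω : Type*} [MeasurableSpace Ω]

/-- `τ_N` is monotone in the autocorrelation sequence: the Fejér weights `1 − (t+1)/N` are
nonnegative for `t < N`. -/
theorem tauIntN_mono {ρ ρ' : ℕ → ℝ} (h : ∀ t, ρ (t + 1) ≤ ρ' (t + 1)) (N : ℕ) :
    tauIntN ρ N ≤ tauIntN ρ' N := by
  unfold tauIntN
  have hs : ∑ t ∈ Finset.range N, (1 - ((t : ℝ) + 1) / N) * ρ (t + 1)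
      ≤ ∑ t ∈ Finset.range N, (1 - ((t : ℝ) + 1) / N) * ρ' (t + 1) := by
    refine Finset.sum_le_sum fun t ht => mul_le_mul_of_nonneg_left (h t) ?_
    have ht' : (t : ℝ) + 1 ≤ N := by exact_mod_cast Finset.mem_range.1 ht
    have hN : (0 : ℝ) < N := by
      have : 0 < N := Nat.pos_of_ne_zero (by rintro rfl; simp at ht)
      exact_mod_cast this
    rw [sub_nonneg, div_le_one hN]
    exact ht'
  linarith

section IMH

variable {q : Measure Ω} [IsProbabilityMeasure q] {w : Ω → ℝ} {π : Measure Ω}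
  [IsProbabilityMeasure π]

/-- **THE ERROR-BAR FLOOR OF THE FLOW SAMPLER.**  For `K = indepMH q w` with `w · q = π`, every
bounded measurable `f` and every `N ≥ 1`, along the chain started in `π` (Mathlib's
`Kernel.trajMeasure`): `2 τ_N(t ↦ ρ₁ᵗ) · Var_π f / N ≤ Var[(1/N) Σ_{i<N} f(X_i)]`, `ρ₁ = ρ_f(1)`. -/
theorem indepMH_variance_timeAverage_ge (hw : Measurable w) (hw0 : ∀ x, 0 < w x)
    (hwi : Integrable w q) (hπ : (q.withDensity fun x => ENNReal.ofReal (w x)) = π)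
    {f : Ω → ℝ} (hf : Measurable f) {C : ℝ} (hC : ∀ x, |f x| ≤ C) {N : ℕ} (hN : N ≠ 0) :
    haveI : Fact (Measurable w) := ⟨hw⟩
    2 * tauIntN (fun t => (autocov (indepMH q w) π (fun y => f y - ∫ z, f z ∂π) 1
          / autocov (indepMH q w) π (fun y => f y - ∫ z, f z ∂π) 0) ^ t) N
        * autocov (indepMH q w) π (fun y => f y - ∫ z, f z ∂π) 0 / N
      ≤ Var[fun x : ℕ → Ω => (∑ i ∈ Finset.range N, f (x i)) / N;
          Kernel.trajMeasure (X := fun _ : ℕ => Ω) π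
            (fun n : ℕ => (indepMH q w).comap
              (fun h : (i : ↥(Finset.Iic n)) → Ω => h ⟨n, Finset.mem_Iic.2 le_rfl⟩)
              (measurable_pi_apply _))] := by
  haveI : Fact (Measurable w) := ⟨hw⟩
  have hinv : Kernel.Invariant (indepMH q w) π := by rw [← hπ]; exact indepMH_invariant hw hw0
  set g := fun y => f y - ∫ z, f z ∂π with hg
  have hgm : Measurable g := hf.sub measurable_const
  have hgb : ∀ y, |g y| ≤ C + |∫ z, f z ∂π| := fun y =>
    (abs_sub _ _).trans (add_le_add (hC y) le_rfl)
  have hσ0 : 0 ≤ autocov (indepMH q w) π g 0 := by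
    rw [autocov_zero]; exact integral_nonneg fun _ => sq_nonneg _
  have hNpos : (0 : ℝ) < N := by exact_mod_cast Nat.pos_of_ne_zero hN
  rcases hσ0.eq_or_lt with hz | hpos
  · -- degenerate observable: the floor is `0`
    rw [← hz, mul_zero, zero_div]
    exact variance_nonneg _ _
  · have hmono : tauIntN (fun t => (autocov (indepMH q w) π g 1 / autocov (indepMH q w) π g 0) ^ t) N
        ≤ tauIntN (fun t => autocov (indepMH q w) π g t / autocov (indepMH q w) π g 0) N :=
      tauIntN_mono (fun t => indepMH_acf_pow_le hw hw0 hwi hπ hgm hgb t) N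
    rw [variance_timeAverage hinv hf hC hN hpos.ne']
    have h2 : 0 ≤ 2 * autocov (indepMH q w) π g 0 / N := by positivity
    calc 2 * tauIntN (fun t => (autocov (indepMH q w) π g 1 / autocov (indepMH q w) π g 0) ^ t) N
          * autocov (indepMH q w) π g 0 / N
        = tauIntN (fun t => (autocov (indepMH q w) π g 1 / autocov (indepMH q w) π g 0) ^ t) N
            * (2 * autocov (indepMH q w) π g 0 / N) := by ring
      _ ≤ tauIntN (fun t => autocov (indepMH q w) π g t / autocov (indepMH q w) π g 0) N
            * (2 * autocov (indepMH q w) π g 0 / N) := mul_le_mul_of_nonneg_right hmono h2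
      _ = 2 * tauIntN (fun t => autocov (indepMH q w) π g t / autocov (indepMH q w) π g 0) N
            * autocov (indepMH q w) π g 0 / N := by ring

/-- **Closed form**: with `0 ≤ ρ₁ < 1` (`ρ₁ = ρ_f(1)`; `ρ₁ ≥ 0` is automatic, `ρ₁ < 1` holds
whenever `ρ_f` is summable), for every `N ≥ 1`:
`(Var_π f / N) · ((1 + ρ₁)/(1 − ρ₁) − 2ρ₁(1 − ρ₁^N)/(N(1 − ρ₁)²)) ≤ Var[(1/N) Σ_{i<N} f(X_i)]`. -/
theorem indepMH_variance_timeAverage_ge_closed (hw : Measurable w) (hw0 : ∀ x, 0 < w x)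
    (hwi : Integrable w q) (hπ : (q.withDensity fun x => ENNReal.ofReal (w x)) = π)
    {f : Ω → ℝ} (hf : Measurable f) {C : ℝ} (hC : ∀ x, |f x| ≤ C) {N : ℕ} (hN : N ≠ 0)
    (hρ1 : autocov (indepMH q w) π (fun y => f y - ∫ z, f z ∂π) 1
      / autocov (indepMH q w) π (fun y => f y - ∫ z, f z ∂π) 0 < 1) :
    haveI : Fact (Measurable w) := ⟨hw⟩
    let ρ₁ := autocov (indepMH q w) π (fun y => f y - ∫ z, f z ∂π) 1
      / autocov (indepMH q w) π (fun y => f y - ∫ z, f z ∂π) 0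
    autocov (indepMH q w) π (fun y => f y - ∫ z, f z ∂π) 0 / N
          * ((1 + ρ₁) / (1 - ρ₁) - 2 * ρ₁ * (1 - ρ₁ ^ N) / (N * (1 - ρ₁) ^ 2))
      ≤ Var[fun x : ℕ → Ω => (∑ i ∈ Finset.range N, f (x i)) / N;
          Kernel.trajMeasure (X := fun _ : ℕ => Ω) π
            (fun n : ℕ => (indepMH q w).comap
              (fun h : (i : ↥(Finset.Iic n)) → Ω => h ⟨n, Finset.mem_Iic.2 le_rfl⟩)
              (measurable_pi_apply _))] := by
  intro ρ₁
  have hρ0 : 0 ≤ ρ₁ := indepMH_acf_nonneg hw hw0 hwi hπ (hf.sub measurable_const) (C := C + |∫ z, f z ∂π|)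
    (fun y => (abs_sub _ _).trans (add_le_add (hC y) le_rfl)) 1
  have habs : |ρ₁| < 1 := abs_lt.2 ⟨by linarith, hρ1⟩
  have hgeo : tauIntN (fun t => ρ₁ ^ t) N
      = (1 + ρ₁) / (2 * (1 - ρ₁)) - ρ₁ * (1 - ρ₁ ^ N) / (N * (1 - ρ₁) ^ 2) := by
    have h := tauInt_sub_tauIntN_geometric habs hN
    rw [tauInt_geometric habs] at h
    linarith
  have hmain := indepMH_variance_timeAverage_ge hw hw0 hwi hπ hf hC hN
  refine le_trans (le_of_eq ?_) hmain
  show _ = 2 * tauIntN (fun t => ρ₁ ^ t) N * _ / N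
  rw [hgeo]
  have h1 : (1 : ℝ) - ρ₁ ≠ 0 := by linarith
  have hN' : (N : ℝ) ≠ 0 := by exact_mod_cast hN
  field_simp

end IMH

end Summit.Ventures.LatticeQCDFlow.Scoring

end
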